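import Summits.Ventures.LatticeQCDFlow.Scaling.LadderRobinMode

/-!
HONEST FRAMING: exact (Metropolis-corrected) sampling algorithms for lattice gauge theory; figures
of merit are autocorrelation/cost numbers at stated couplings and volumes; no continuum-physics
claim.

# LadderRobinModeHotRate — THE ROBIN MODE'S RATE IS AT MOST THE HOT REFRESH RATE PER REPLICA: **`2(K+1)·ρ ≤ 3π·h`**, SO `1/ρ ≥ max{K(2K+1)²/(π²t), 2(K+1)/(3πh)}` — THE
# FLOOR SIDE OF THE HOMOGENEOUS LADDER IN BOTH CHANNELS (lean-2 GEN-47, ours)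

Venture-side (OURS).  Cell `lqcd-flow` (pub-lqcd), unit `pub-lqcd-lean-2-g47`, 2026-08-31.  Chapter AG, file 11 — Mathlib only, companion of files 1 and 5.  File 1 bounded the rate of the slowest
one-level mode by the swap channel, `ρ ≤ tπ²/(K(2K+1)²)`, uniformly in the hot rate `h`.  This file bounds it by the HOT channel, uniformly in `t`: the Robin equation in product form
`h·c_0 = (2t/K)·sin(θ(K+1))·sin(θ/2)` with `c_0 ≤ 1`, `sin(θ/2) ≥ θ/π` (Jordan) and `sin(θ(K+1)) ≥ θ(K+1)/3` (`θ(K+1) ≤ 2π/3`; Jordan below `π/2`, `sin ≥ √2/2` on `[π/2, 2π/3]`) gives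
`h ≥ 2tθ²(K+1)/(3πK)`, while `ρ ≤ tθ²/K` (file 1): **`2(K+1)ρ ≤ 3πh`**.  With file 3's floor `((1−ρ)/ρ)·(½·log(K+1) − log(24√5)) ≤ t_mix(1/4)` this is the law-free floor
`(2(K+1)/(3πh) − 1)·(½·log(K+1) − log(24√5))` of file 12 — the hot channel WITH the logarithm — against file 9's ceiling term `(π²(K+1)/(2√2h))·log`: the homogeneous ladder is
`Θ(max{K³/t, K/h}·log K)` two-sided in `K`, `t` AND `h`.  Hypothesis-equations as in file 1; no definitions.

* `sin_ge_third_of_le` (`x/3 ≤ sin x` on `[0, 2π/3]`), **`robinMode_hot_ge_theta_sq`** (`2tθ²(K+1) ≤ 3πKh`), **`robinMode_rho_hot_le`** (`2(K+1)ρ ≤ 3πh`),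
  **`robinMode_inv_rho_ge_hot`** (`2(K+1)/(3πh) ≤ 1/ρ`).

Literature grade (cell rule): ELEMENTARY, NEW TYPING; nothing cited; no new bib keys.
-/

noncomputable section

open Finset Real

namespace Summit.Ventures.LatticeQCDFlow.Scaling

section RobinModeHot
variable {K : ℕ} {t h θ ρ : ℝ} {c : ℕ → ℝ}

/-- `x/3 ≤ sin x` for `0 ≤ x ≤ 2π/3` (Jordan's inequality below `π/2`; `sin x ≥ √2/2 ≥ x/3` on `[π/2, 2π/3]`). [ours] -/
theorem sin_ge_third_of_le {x : ℝ} (hx0 : 0 ≤ x) (hx1 : 3 * x ≤ 2 * π) : x / 3 ≤ Real.sin x := by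
  have hpi := Real.pi_lt_d2
  have hpi3 := Real.pi_gt_three
  by_cases hx : x ≤ π / 2
  · have hj := Real.mul_le_sin hx0 hx
    have h13 : (1 : ℝ) / 3 ≤ 2 / π := by
      rw [div_le_div_iff₀ (by norm_num) Real.pi_pos]; linarith
    have : x / 3 ≤ 2 / π * x := by
      calc x / 3 = 1 / 3 * x := by ring
        _ ≤ 2 / π * x := mul_le_mul_of_nonneg_right h13 hx0
    linarith
  · push Not at hx
    -- `sin x = cos(π/2 − x) ≥ cos(π/4) = √2/2` since `|π/2 − x| ≤ π/4`
    have hs2 : Real.sqrt 2 * Real.sqrt 2 = 2 := Real.mul_self_sqrt (by norm_num)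
    have hs2pos : 0 < Real.sqrt 2 := Real.sqrt_pos.mpr (by norm_num)
    have h1 : Real.sqrt 2 / 2 ≤ Real.sin x := by
      rw [← Real.cos_pi_div_two_sub, ← Real.cos_pi_div_four, ← Real.cos_abs (π / 2 - x)]
      refine Real.cos_le_cos_of_nonneg_of_le_pi (abs_nonneg _) (by linarith [Real.pi_pos]) ?_
      rw [abs_le]; constructor <;> nlinarith [Real.pi_pos]
    -- `x/3 ≤ 2π/9 ≤ 0.7 ≤ √2/2`
    have h2 : x / 3 ≤ 0.7 := by linarith
    have h3 : (0.7 : ℝ) ≤ Real.sqrt 2 / 2 := by nlinarith [hs2]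
    linarith

/-- **THE HOT CHANNEL BOUNDS `θ`:** `2tθ²(K+1) ≤ 3πK·h` at a Robin root (`K ≥ 1`, `t > 0`, `0 < θ`, `θ(2K+1) < π`). [ours] -/
theorem robinMode_hot_ge_theta_sq (hK : 1 ≤ K) (ht : 0 < t) (hθ0 : 0 < θ) (hθ1 : θ * (2 * K + 1) < π)
    (hc : ∀ n : ℕ, c n = Real.cos (θ * ((K : ℝ) + 1 / 2 - n)))
    (hrobin : h * Real.cos (θ * ((K : ℝ) + 1 / 2)) = t / K * (Real.cos (θ * ((K : ℝ) + 1 / 2)) - Real.cos (θ * ((K : ℝ) + 3 / 2)))) :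
    2 * t * θ ^ 2 * ((K : ℝ) + 1) ≤ 3 * π * K * h := by
  have hKpos : (0 : ℝ) < K := Nat.cast_pos.mpr (by omega)
  have hK1 : (1 : ℝ) ≤ K := by exact_mod_cast hK
  have h0 : c 0 = Real.cos (θ * ((K : ℝ) + 1 / 2)) := by rw [hc]; push_cast; ring_nf
  obtain ⟨hc00, hc01⟩ := robinMode_c0_nonneg hθ0 hθ1 hc
  -- product form of the Robin equation (as in file 1)
  have hdiff : Real.cos (θ * ((K : ℝ) + 1 / 2)) - Real.cos (θ * ((K : ℝ) + 3 / 2)) = 2 * Real.sin (θ * ((K : ℝ) + 1)) * Real.sin (θ / 2) := by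
    rw [Real.cos_sub_cos]
    have e1 : (θ * ((K : ℝ) + 1 / 2) + θ * ((K : ℝ) + 3 / 2)) / 2 = θ * ((K : ℝ) + 1) := by ring
    have e2 : (θ * ((K : ℝ) + 1 / 2) - θ * ((K : ℝ) + 3 / 2)) / 2 = -(θ / 2) := by ring
    rw [e1, e2, Real.sin_neg]; ring
  have hprod : h * c 0 = 2 * t / K * Real.sin (θ * ((K : ℝ) + 1)) * Real.sin (θ / 2) := by rw [h0, hrobin, hdiff]; ring
  -- the two sine factors from below
  have hs1 : θ * ((K : ℝ) + 1) / 3 ≤ Real.sin (θ * ((K : ℝ) + 1)) :=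
    sin_ge_third_of_le (by positivity) (by nlinarith [Real.pi_pos])
  have hs2 : θ / π ≤ Real.sin (θ / 2) := by
    have := Real.mul_le_sin (show 0 ≤ θ / 2 by positivity) (by nlinarith [Real.pi_pos])
    have e : 2 / π * (θ / 2) = θ / π := by ring
    linarith [e]
  have hlow : 2 * t / K * (θ * ((K : ℝ) + 1) / 3) * (θ / π) ≤ h * c 0 := by
    rw [hprod]
    have := mul_le_mul hs1 hs2 (by positivity) (le_trans (by positivity) hs1)
    calc 2 * t / K * (θ * ((K : ℝ) + 1) / 3) * (θ / π) = 2 * t / K * (θ * ((K : ℝ) + 1) / 3 * (θ / π)) := by ring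
      _ ≤ 2 * t / K * (Real.sin (θ * ((K : ℝ) + 1)) * Real.sin (θ / 2)) := mul_le_mul_of_nonneg_left this (by positivity)
      _ = _ := by ring
  -- `h·c_0 ≤ h` needs `h ≥ 0`, which follows from the product form
  have hh0 : 0 ≤ h * c 0 := le_trans (by positivity) hlow
  have hhc : h * c 0 ≤ h := by
    by_cases hc0 : c 0 = 0
    · rw [hc0, mul_zero] at hh0 ⊢
      by_contra hneg; push Not at hneg
      -- then `h·c_0 = 0` forces the lower bound `≤ 0`, contradiction with positivity
      have : 2 * t / K * (θ * ((K : ℝ) + 1) / 3) * (θ / π) ≤ 0 := by rw [hc0, mul_zero] at hlow; exact hlow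
      have : 0 < 2 * t / K * (θ * ((K : ℝ) + 1) / 3) * (θ / π) := by positivity
      linarith
    · have hc0pos : 0 < c 0 := lt_of_le_of_ne hc00 (Ne.symm hc0)
      have hh : 0 ≤ h := by
        by_contra hneg; push Not at hneg
        have : h * c 0 < 0 := mul_neg_of_neg_of_pos hneg hc0pos
        linarith
      calc h * c 0 ≤ h * 1 := mul_le_mul_of_nonneg_left hc01 hh
        _ = h := mul_one _
  have e : 2 * t / K * (θ * ((K : ℝ) + 1) / 3) * (θ / π) * (3 * π * K) = 2 * t * θ ^ 2 * ((K : ℝ) + 1) := by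
    field_simp
  calc 2 * t * θ ^ 2 * ((K : ℝ) + 1) = 2 * t / K * (θ * ((K : ℝ) + 1) / 3) * (θ / π) * (3 * π * K) := e.symm
    _ ≤ h * (3 * π * K) := mul_le_mul_of_nonneg_right (hlow.trans hhc) (by positivity)
    _ = 3 * π * K * h := by ring

/-- **THE RATE IS AT MOST THE HOT REFRESH RATE PER REPLICA: `2(K+1)·ρ ≤ 3π·h`.** [ours] -/
theorem robinMode_rho_hot_le (hK : 1 ≤ K) (ht : 0 < t) (hθ0 : 0 < θ) (hθ1 : θ * (2 * K + 1) < π)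
    (hc : ∀ n : ℕ, c n = Real.cos (θ * ((K : ℝ) + 1 / 2 - n))) (hρ : ρ = 2 * t / K * (1 - Real.cos θ))
    (hrobin : h * Real.cos (θ * ((K : ℝ) + 1 / 2)) = t / K * (Real.cos (θ * ((K : ℝ) + 1 / 2)) - Real.cos (θ * ((K : ℝ) + 3 / 2)))) :
    2 * ((K : ℝ) + 1) * ρ ≤ 3 * π * h := by
  have hKpos : (0 : ℝ) < K := Nat.cast_pos.mpr (by omega)
  have h1 := robinMode_hot_ge_theta_sq hK ht hθ0 hθ1 hc hrobin
  -- `ρ ≤ tθ²/K`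
  have hcos : 1 - Real.cos θ ≤ θ ^ 2 / 2 := by linarith [Real.one_sub_sq_div_two_le_cos (x := θ)]
  have hρle : ρ * K ≤ t * θ ^ 2 := by
    rw [hρ]
    have e : 2 * t / K * (1 - Real.cos θ) * K = 2 * t * (1 - Real.cos θ) := by field_simp
    rw [e]; nlinarith
  -- `2(K+1)ρ·K ≤ 2tθ²(K+1) ≤ 3πKh`
  have h2 : 2 * ((K : ℝ) + 1) * ρ * K ≤ 3 * π * K * h := by nlinarith
  exact le_of_mul_le_mul_right (by linarith) hKpos

/-- **`1/ρ ≥ 2(K+1)/(3πh)`** (`h > 0`). [ours] -/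
theorem robinMode_inv_rho_ge_hot (hK : 1 ≤ K) (ht : 0 < t) (hh : 0 < h) (hθ0 : 0 < θ) (hθ1 : θ * (2 * K + 1) < π)
    (hc : ∀ n : ℕ, c n = Real.cos (θ * ((K : ℝ) + 1 / 2 - n))) (hρ : ρ = 2 * t / K * (1 - Real.cos θ))
    (hrobin : h * Real.cos (θ * ((K : ℝ) + 1 / 2)) = t / K * (Real.cos (θ * ((K : ℝ) + 1 / 2)) - Real.cos (θ * ((K : ℝ) + 3 / 2)))) :
    2 * ((K : ℝ) + 1) / (3 * π * h) ≤ 1 / ρ := by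
  have hρ0 := robinMode_rho_pos hK ht hθ0 hθ1 hρ
  have h1 := robinMode_rho_hot_le hK ht hθ0 hθ1 hc hρ hrobin
  rw [div_le_div_iff₀ (by positivity) hρ0]
  linarith

end RobinModeHot

end Summit.Ventures.LatticeQCDFlow.Scaling

end
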